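import Summits.HodgeConjecture.CorCM.MultiFieldWeilUnitGram
import HarnessLib

/-!
# MULTI-FIELD WEIL ENGINE — FOUR `2`-SETS ON FIVE LETTERS: the `185` independent quadruples (every letter pattern except the four-cycle and the triangle with the disjoint
# edge), the rank bound `#classes < #letters`, transport of the centred indicators along a bijection of the letters (census level)

Cell `pub-hodgecm2` (COR-CM), seat b30 gen 40 (2026-08-26); count-neutral own lane MULTI-FIELD WEIL ENGINE (stem `MultiFieldWeil*`), census level (pure linear algebra of finite
sets), sequel of `CorCM/MultiFieldWeilUnitGram.lean` (U5a: the Gram equations of a dependency and the independent TRIPLES).  Theorems only; no definition, no named fact, no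
`sorry`, no `decide` beyond four-element enumerations.  HONEST FRAMING: pure finite combinatorics; `HC_CM` is NOT touched.

The centred indicator of a set `Q` of letters is the function `y ↦ k·[y ∈ Q] − |Q|` on the `k` letters; by U1 (`const_of_signed_unit_of_linearIndependent`) a unit of slots over
ONE CM field separates — every defect is constant — as soon as the centred indicators of the slots' position sets are linearly independent over `ℚ`, and the criterion is sharp.

* §1 `sum_eq_four`, `exists_enum_of_card_eq_three/four` — bookkeeping for index types of three and four elements; `linearIndependent_cells_map_equiv_iff` — TRANSPORT of the
  centred indicators along a bijection of the letters (the realised reading lives on the `τ`-embeddings of a field, the census on `Fin k`).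
* §2 `sum_cells_eq_zero` — a centred indicator has total mass zero; `fintype_card_lt_of_linearIndependent_of_sum_eq_zero` and **`fintype_card_lt_of_linearIndependent_cells`** —
  THE RANK BOUND: independent centred indicators on `k ≥ 1` letters number at most `k − 1` (they live in the hyperplane of mass zero).  So the units method never separates
  `k` classes over a field with `k` embeddings above `τ`: three sextic, four octic, five decic classes are beyond it (honest limit, now a theorem).
* §3 `apply_cells_eq_zero_of_sum_smul_eq_zero` — a dependency read at one letter; `det_mul_eq_zero_of_gram_four` — THE ADJUGATE IDENTITY for the symmetric `4 × 4` system
  (uniform: `det · gᵢ` is a polynomial combination of the four Gram equations, `linear_combination`); `gram_det_four_pairs_five` — the determinant at the `64` disjointness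
  patterns (Gram entries `30` diagonal, `5` for sets meeting once, `−20` for disjoint sets, all divided by `5`): exactly `7` are singular — the four CLAWS (one set disjoint from
  the other three = the TRIANGLE WITH THE DISJOINT EDGE, excluded by (H1)) and the three PERFECT MATCHINGS (the FOUR-CYCLES, excluded by (H2): `fourCycle_five_aux`, the
  dependency read at the odd letter kills the kernel vector `(1, −1, 1, −1)`); **`linearIndependent_cells_of_four_pairs_five`** — FOUR DISTINCT `2`-SETS ON FIVE LETTERS whose
  letter pattern satisfies (H1) every set meets another one and (H2) some letter lies in `1`, `3` or `4` of the sets, have independent centred indicators; card forms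
  `…_of_card_eq_four` and (U5a's triple lemma) `…three_pairs_five_of_card_eq_three`.  As graphs on five vertices the admissible patterns are the path `P₅`, the chair, the star
  `K_{1,4}` and the paw with an isolated vertex: `185` of the `210` quadruples.
* §4 HONESTY: `not_linearIndependent_cells_fourCycle_five` and `not_linearIndependent_cells_triangle_edge_five` — the two excluded patterns ARE dependent (explicit relations
  `v₀₁ − v₁₂ + v₂₃ − v₃₀ = 0` and `v₀₁ + v₀₂ + v₁₂ + 2·v₃₄ = 0`).
USE (sequel, the units menu by shapes): per decic CM field through `k` with `2`-transitive quintic part, FOUR pairwise non-isogenous `(2,3)`/`(3,2)`-fivefolds whose types over `τ`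
satisfy (H1)–(H2) separate; with §2 this is the end of the decic census (five classes never separate).
[cite: Lang2002, XIII §4; XV §1] [cite: DixonMortimer1996, §2.1]

## References
* [Lang2002] S. Lang, *Algebra*, GTM 211, XIII §4 (linear independence, rank, dimension of a hyperplane), XV §1 (bilinear forms, Gram matrices).
* [DixonMortimer1996] J. D. Dixon, B. Mortimer, *Permutation Groups*, GTM 163, §2.1.
-/

noncomputable section

namespace Summit.HodgeConjecture.CorCM.MultiFieldWeil

open Finset

open scoped Classical

/-! ## §1 Index types of three and four elements; transport along a bijection of the letters -/

section Enumeration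

/-- Sums over an index type with exactly four elements. [folklore] -/
theorem sum_eq_four {ι M : Type} [Fintype ι] [AddCommMonoid M] (i₁ i₂ i₃ i₄ : ι) (h₁₂ : i₁ ≠ i₂) (h₁₃ : i₁ ≠ i₃) (h₁₄ : i₁ ≠ i₄) (h₂₃ : i₂ ≠ i₃) (h₂₄ : i₂ ≠ i₄)
    (h₃₄ : i₃ ≠ i₄) (huniv : ∀ i, i = i₁ ∨ i = i₂ ∨ i = i₃ ∨ i = i₄) (f : ι → M) : (∑ i, f i) = f i₁ + f i₂ + f i₃ + f i₄ := by
  have hu : (Finset.univ : Finset ι) = {i₁, i₂, i₃, i₄} := by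
    ext i; simp only [Finset.mem_univ, Finset.mem_insert, Finset.mem_singleton, true_iff]; exact huniv i
  rw [hu, Finset.sum_insert (by simp [h₁₂, h₁₃, h₁₄]), Finset.sum_insert (by simp [h₂₃, h₂₄]), Finset.sum_insert (by simp [h₃₄]), Finset.sum_singleton,
    ← add_assoc, ← add_assoc]

/-- An index type with three elements, enumerated. [folklore] -/
theorem exists_enum_of_card_eq_three {ι : Type} [Fintype ι] (hι : Fintype.card ι = 3) :
    ∃ i₁ i₂ i₃ : ι, i₁ ≠ i₂ ∧ i₁ ≠ i₃ ∧ i₂ ≠ i₃ ∧ ∀ i, i = i₁ ∨ i = i₂ ∨ i = i₃ := by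
  let e : ι ≃ Fin 3 := Fintype.equivFinOfCardEq hι
  refine ⟨e.symm 0, e.symm 1, e.symm 2, fun h => absurd (e.symm.injective h) (by decide), fun h => absurd (e.symm.injective h) (by decide),
    fun h => absurd (e.symm.injective h) (by decide), fun i => ?_⟩
  have h3 : ∀ x : Fin 3, x = 0 ∨ x = 1 ∨ x = 2 := by decide
  rcases h3 (e i) with h | h | h
  · exact Or.inl (by rw [← h, Equiv.symm_apply_apply])
  · exact Or.inr (Or.inl (by rw [← h, Equiv.symm_apply_apply]))
  · exact Or.inr (Or.inr (by rw [← h, Equiv.symm_apply_apply]))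

/-- An index type with four elements, enumerated. [folklore] -/
theorem exists_enum_of_card_eq_four {ι : Type} [Fintype ι] (hι : Fintype.card ι = 4) :
    ∃ i₁ i₂ i₃ i₄ : ι, i₁ ≠ i₂ ∧ i₁ ≠ i₃ ∧ i₁ ≠ i₄ ∧ i₂ ≠ i₃ ∧ i₂ ≠ i₄ ∧ i₃ ≠ i₄ ∧ ∀ i, i = i₁ ∨ i = i₂ ∨ i = i₃ ∨ i = i₄ := by
  let e : ι ≃ Fin 4 := Fintype.equivFinOfCardEq hι
  refine ⟨e.symm 0, e.symm 1, e.symm 2, e.symm 3, fun h => absurd (e.symm.injective h) (by decide), fun h => absurd (e.symm.injective h) (by decide),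
    fun h => absurd (e.symm.injective h) (by decide), fun h => absurd (e.symm.injective h) (by decide), fun h => absurd (e.symm.injective h) (by decide),
    fun h => absurd (e.symm.injective h) (by decide), fun i => ?_⟩
  have h4 : ∀ x : Fin 4, x = 0 ∨ x = 1 ∨ x = 2 ∨ x = 3 := by decide
  rcases h4 (e i) with h | h | h | h
  · exact Or.inl (by rw [← h, Equiv.symm_apply_apply])
  · exact Or.inr (Or.inl (by rw [← h, Equiv.symm_apply_apply]))
  · exact Or.inr (Or.inr (Or.inl (by rw [← h, Equiv.symm_apply_apply])))
  · exact Or.inr (Or.inr (Or.inr (by rw [← h, Equiv.symm_apply_apply])))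

/-- **TRANSPORT OF THE CENTRED INDICATORS ALONG A BIJECTION OF THE LETTERS**: independence of the functions `b ↦ n·[b ∈ e(Q_i)] − c_i` on `β` is independence of the
functions `a ↦ n·[a ∈ Q_i] − c_i` on `α`. [cite: Lang2002, XIII §4] -/
theorem linearIndependent_cells_map_equiv_iff {α β ι : Type} [Fintype α] [Fintype β] (e : α ≃ β) (Q : ι → Finset α) (n : ℚ) (c : ι → ℚ) :
    (LinearIndependent ℚ fun i => fun b : β => n * (if b ∈ (Q i).map e.toEmbedding then 1 else 0) - c i) ↔
      LinearIndependent ℚ fun i => fun a : α => n * (if a ∈ Q i then 1 else 0) - c i := by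
  let F : (β → ℚ) ≃ₗ[ℚ] (α → ℚ) := LinearEquiv.funCongrLeft ℚ ℚ e
  have hF : (F : (β → ℚ) →ₗ[ℚ] (α → ℚ)) ∘ (fun i => fun b : β => n * (if b ∈ (Q i).map e.toEmbedding then 1 else 0) - c i) =
      fun i => fun a : α => n * (if a ∈ Q i then 1 else 0) - c i := by
    funext i a
    simp only [Function.comp_apply, LinearEquiv.coe_coe, F, LinearEquiv.funCongrLeft_apply, LinearMap.funLeft_apply, Finset.mem_map_equiv,
      Equiv.symm_apply_apply]
  rw [← hF]
  exact ((F : (β → ℚ) →ₗ[ℚ] (α → ℚ)).linearIndependent_iff_of_injOn F.injective.injOn).symm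

end Enumeration

/-! ## §2 The rank bound: independent centred indicators on `k` letters number at most `k − 1` -/

section Rank

variable {k : ℕ}

/-- A centred indicator has total mass zero: `Σ_y (k·[y ∈ Q] − |Q|) = 0`. [cite: Lang2002, XIII §4] -/
theorem sum_cells_eq_zero (Q : Finset (Fin k)) : (∑ y : Fin k, ((k : ℚ) * (if y ∈ Q then 1 else 0) - Q.card)) = 0 := by
  have hQ : (∑ y : Fin k, (if y ∈ Q then (1 : ℚ) else 0)) = Q.card := by rw [Finset.sum_boole, Finset.filter_mem_eq_inter, Finset.univ_inter]
  rw [Finset.sum_sub_distrib, ← Finset.mul_sum, hQ, Finset.sum_const, Finset.card_univ, Fintype.card_fin, nsmul_eq_mul]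
  ring

/-- **Independent functions of mass zero on `k ≥ 1` letters number at most `k − 1`** (they lie in a hyperplane). [cite: Lang2002, XIII §4] -/
theorem fintype_card_lt_of_linearIndependent_of_sum_eq_zero (hk : 0 < k) {ι : Type} [Fintype ι] {v : ι → Fin k → ℚ} (hv : ∀ i, (∑ y, v i y) = 0)
    (hli : LinearIndependent ℚ v) : Fintype.card ι < k := by
  -- the mass functional and its kernel
  let L : (Fin k → ℚ) →ₗ[ℚ] ℚ :=
    { toFun := fun f => ∑ y, f y
      map_add' := fun f g => by simp only [Pi.add_apply, Finset.sum_add_distrib]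
      map_smul' := fun a f => by simp only [Pi.smul_apply, smul_eq_mul, RingHom.id_apply, Finset.mul_sum] }
  have hmem : ∀ i, v i ∈ LinearMap.ker L := fun i => by rw [LinearMap.mem_ker]; exact hv i
  have hli' : LinearIndependent ℚ fun i => (⟨v i, hmem i⟩ : LinearMap.ker L) := LinearIndependent.of_comp (LinearMap.ker L).subtype hli
  have h1 := hli'.fintype_card_le_finrank
  have htop : LinearMap.ker L ≠ ⊤ := fun h => by
    have h1mem : (fun _ : Fin k => (1 : ℚ)) ∈ LinearMap.ker L := by rw [h]; exact Submodule.mem_top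
    rw [LinearMap.mem_ker] at h1mem
    have hsum : L (fun _ : Fin k => (1 : ℚ)) = k := by
      show (∑ _y : Fin k, (1 : ℚ)) = k
      rw [Finset.sum_const, Finset.card_univ, Fintype.card_fin, nsmul_eq_mul, mul_one]
    rw [hsum] at h1mem
    exact (Nat.cast_eq_zero.1 h1mem ▸ hk : (0 : ℕ) < 0).false
  have h2 := Submodule.finrank_lt htop
  rw [Module.finrank_fin_fun] at h2
  omega

/-- **THE RANK BOUND OF THE UNITS METHOD: independent centred indicators on `k ≥ 1` letters number at most `k − 1`.**  In the menu: at most two classes over a sextic field,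
three over an octic field, four over a decic field can ever separate. [cite: Lang2002, XIII §4] -/
theorem fintype_card_lt_of_linearIndependent_cells (hk : 0 < k) {ι : Type} [Fintype ι] (Q : ι → Finset (Fin k))
    (hli : LinearIndependent ℚ fun i : ι => fun y : Fin k => ((k : ℚ) * (if y ∈ Q i then 1 else 0) - (Q i).card)) : Fintype.card ι < k :=
  fintype_card_lt_of_linearIndependent_of_sum_eq_zero hk (fun i => sum_cells_eq_zero (Q i)) hli

end Rank

/-! ## §3 Four `2`-sets on five letters -/

section Four

variable {k : ℕ}

/-- **A dependency read at one letter**: if `Σ_i g_i (k·𝟙_{Q_i} − |Q_i|) = 0` then `Σ_i g_i (k·[y ∈ Q_i] − |Q_i|) = 0` for every letter `y`. [cite: Lang2002, XIII §4] -/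
theorem apply_cells_eq_zero_of_sum_smul_eq_zero {ι : Type} [Fintype ι] (Q : ι → Finset (Fin k)) {g : ι → ℚ}
    (hg : (∑ i, g i • fun y : Fin k => ((k : ℚ) * (if y ∈ Q i then 1 else 0) - (Q i).card)) = 0) (y : Fin k) :
    (∑ i, g i * ((k : ℚ) * (if y ∈ Q i then 1 else 0) - (Q i).card)) = 0 := by
  have h := congrFun hg y
  rw [Finset.sum_apply, Pi.zero_apply] at h
  simpa only [Pi.smul_apply, smul_eq_mul] using h

/-- **THE ADJUGATE IDENTITY** for the symmetric `4 × 4` system with diagonal `6` and off-diagonal entries `xᵢⱼ`: `det · gᵢ` is a polynomial combination of the four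
equations, so a regular Gram matrix forces the trivial dependency — uniformly, with no case analysis. [cite: Lang2002, XIII §4; XV §1] -/
theorem det_mul_eq_zero_of_gram_four (g₁ g₂ g₃ g₄ x₁₂ x₁₃ x₁₄ x₂₃ x₂₄ x₃₄ : ℚ) (E₁ : 6 * g₁ + x₁₂ * g₂ + x₁₃ * g₃ + x₁₄ * g₄ = 0)
    (E₂ : x₁₂ * g₁ + 6 * g₂ + x₂₃ * g₃ + x₂₄ * g₄ = 0) (E₃ : x₁₃ * g₁ + x₂₃ * g₂ + 6 * g₃ + x₃₄ * g₄ = 0) (E₄ : x₁₄ * g₁ + x₂₄ * g₂ + x₃₄ * g₃ + 6 * g₄ = 0) :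
    (x₁₄ ^ 2 * x₂₃ ^ 2 - 2 * x₁₃ * x₁₄ * x₂₃ * x₂₄ + x₁₃ ^ 2 * x₂₄ ^ 2 - 2 * x₁₂ * x₁₄ * x₂₃ * x₃₄ - 2 * x₁₂ * x₁₃ * x₂₄ * x₃₄ + x₁₂ ^ 2 * x₃₄ ^ 2 + 12 * x₂₃ * x₂₄ * x₃₄ + 12
      * x₁₃ * x₁₄ * x₃₄ + 12 * x₁₂ * x₁₄ * x₂₄ + 12 * x₁₂ * x₁₃ * x₂₃ - 36 * x₃₄ ^ 2 - 36 * x₂₄ ^ 2 - 36 * x₂₃ ^ 2 - 36 * x₁₄ ^ 2 - 36 * x₁₃ ^ 2 - 36 * x₁₂ ^ 2 + 1296) * g₁ = 0 ∧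
    (x₁₄ ^ 2 * x₂₃ ^ 2 - 2 * x₁₃ * x₁₄ * x₂₃ * x₂₄ + x₁₃ ^ 2 * x₂₄ ^ 2 - 2 * x₁₂ * x₁₄ * x₂₃ * x₃₄ - 2 * x₁₂ * x₁₃ * x₂₄ * x₃₄ + x₁₂ ^ 2 * x₃₄ ^ 2 + 12 * x₂₃ * x₂₄ * x₃₄ + 12
      * x₁₃ * x₁₄ * x₃₄ + 12 * x₁₂ * x₁₄ * x₂₄ + 12 * x₁₂ * x₁₃ * x₂₃ - 36 * x₃₄ ^ 2 - 36 * x₂₄ ^ 2 - 36 * x₂₃ ^ 2 - 36 * x₁₄ ^ 2 - 36 * x₁₃ ^ 2 - 36 * x₁₂ ^ 2 + 1296) * g₂ = 0 ∧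
    (x₁₄ ^ 2 * x₂₃ ^ 2 - 2 * x₁₃ * x₁₄ * x₂₃ * x₂₄ + x₁₃ ^ 2 * x₂₄ ^ 2 - 2 * x₁₂ * x₁₄ * x₂₃ * x₃₄ - 2 * x₁₂ * x₁₃ * x₂₄ * x₃₄ + x₁₂ ^ 2 * x₃₄ ^ 2 + 12 * x₂₃ * x₂₄ * x₃₄ + 12
      * x₁₃ * x₁₄ * x₃₄ + 12 * x₁₂ * x₁₄ * x₂₄ + 12 * x₁₂ * x₁₃ * x₂₃ - 36 * x₃₄ ^ 2 - 36 * x₂₄ ^ 2 - 36 * x₂₃ ^ 2 - 36 * x₁₄ ^ 2 - 36 * x₁₃ ^ 2 - 36 * x₁₂ ^ 2 + 1296) * g₃ = 0 ∧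
    (x₁₄ ^ 2 * x₂₃ ^ 2 - 2 * x₁₃ * x₁₄ * x₂₃ * x₂₄ + x₁₃ ^ 2 * x₂₄ ^ 2 - 2 * x₁₂ * x₁₄ * x₂₃ * x₃₄ - 2 * x₁₂ * x₁₃ * x₂₄ * x₃₄ + x₁₂ ^ 2 * x₃₄ ^ 2 + 12 * x₂₃ * x₂₄ * x₃₄ + 12
      * x₁₃ * x₁₄ * x₃₄ + 12 * x₁₂ * x₁₄ * x₂₄ + 12 * x₁₂ * x₁₃ * x₂₃ - 36 * x₃₄ ^ 2 - 36 * x₂₄ ^ 2 - 36 * x₂₃ ^ 2 - 36 * x₁₄ ^ 2 - 36 * x₁₃ ^ 2 - 36 * x₁₂ ^ 2 + 1296) * g₄ = 0 := by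
  refine ⟨?_, ?_, ?_, ?_⟩
  · linear_combination (2 * x₂₃ * x₂₄ * x₃₄ - 6 * x₃₄ ^ 2 - 6 * x₂₄ ^ 2 - 6 * x₂₃ ^ 2 + 216) * E₁ + (-x₁₄ * x₂₃ * x₃₄ - x₁₃ * x₂₄ * x₃₄ + x₁₂ * x₃₄ ^ 2 + 6 * x₁₄ * x₂₄ + 6 *
      x₁₃ * x₂₃ - 36 * x₁₂) * E₂ + (-x₁₄ * x₂₃ * x₂₄ + x₁₃ * x₂₄ ^ 2 - x₁₂ * x₂₄ * x₃₄ + 6 * x₁₄ * x₃₄ + 6 * x₁₂ * x₂₃ - 36 * x₁₃) * E₃ + (x₁₄ * x₂₃ ^ 2 - x₁₃ * x₂₃ * x₂₄ - x₁₂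
      * x₂₃ * x₃₄ + 6 * x₁₃ * x₃₄ + 6 * x₁₂ * x₂₄ - 36 * x₁₄) * E₄
  · linear_combination (-x₁₄ * x₂₃ * x₃₄ - x₁₃ * x₂₄ * x₃₄ + x₁₂ * x₃₄ ^ 2 + 6 * x₁₄ * x₂₄ + 6 * x₁₃ * x₂₃ - 36 * x₁₂) * E₁ + (2 * x₁₃ * x₁₄ * x₃₄ - 6 * x₃₄ ^ 2 - 6 * x₁₄ ^ 2
      - 6 * x₁₃ ^ 2 + 216) * E₂ + (x₁₄ ^ 2 * x₂₃ - x₁₃ * x₁₄ * x₂₄ - x₁₂ * x₁₄ * x₃₄ + 6 * x₂₄ * x₃₄ + 6 * x₁₂ * x₁₃ - 36 * x₂₃) * E₃ + (-x₁₃ * x₁₄ * x₂₃ + x₁₃ ^ 2 * x₂₄ - x₁₂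
      * x₁₃ * x₃₄ + 6 * x₂₃ * x₃₄ + 6 * x₁₂ * x₁₄ - 36 * x₂₄) * E₄
  · linear_combination (-x₁₄ * x₂₃ * x₂₄ + x₁₃ * x₂₄ ^ 2 - x₁₂ * x₂₄ * x₃₄ + 6 * x₁₄ * x₃₄ + 6 * x₁₂ * x₂₃ - 36 * x₁₃) * E₁ + (x₁₄ ^ 2 * x₂₃ - x₁₃ * x₁₄ * x₂₄ - x₁₂ * x₁₄ *
      x₃₄ + 6 * x₂₄ * x₃₄ + 6 * x₁₂ * x₁₃ - 36 * x₂₃) * E₂ + (2 * x₁₂ * x₁₄ * x₂₄ - 6 * x₂₄ ^ 2 - 6 * x₁₄ ^ 2 - 6 * x₁₂ ^ 2 + 216) * E₃ + (-x₁₂ * x₁₄ * x₂₃ - x₁₂ * x₁₃ * x₂₄ +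
      x₁₂ ^ 2 * x₃₄ + 6 * x₂₃ * x₂₄ + 6 * x₁₃ * x₁₄ - 36 * x₃₄) * E₄
  · linear_combination (x₁₄ * x₂₃ ^ 2 - x₁₃ * x₂₃ * x₂₄ - x₁₂ * x₂₃ * x₃₄ + 6 * x₁₃ * x₃₄ + 6 * x₁₂ * x₂₄ - 36 * x₁₄) * E₁ + (-x₁₃ * x₁₄ * x₂₃ + x₁₃ ^ 2 * x₂₄ - x₁₂ * x₁₃ *
      x₃₄ + 6 * x₂₃ * x₃₄ + 6 * x₁₂ * x₁₄ - 36 * x₂₄) * E₂ + (-x₁₂ * x₁₄ * x₂₃ - x₁₂ * x₁₃ * x₂₄ + x₁₂ ^ 2 * x₃₄ + 6 * x₂₃ * x₂₄ + 6 * x₁₃ * x₁₄ - 36 * x₃₄) * E₃ + (2 * x₁₂ *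
      x₁₃ * x₂₃ - 6 * x₂₃ ^ 2 - 6 * x₁₃ ^ 2 - 6 * x₁₂ ^ 2 + 216) * E₄

/-- **THE DETERMINANT AT THE SIXTY-FOUR DISJOINTNESS PATTERNS** `xᵢⱼ = 5aᵢⱼ − 4`, `aᵢⱼ = |Qᵢ ∩ Qⱼ| ∈ {0, 1}`: it vanishes only at the four claws (one set disjoint from the three
others: the triangle with the disjoint edge) and at the three perfect matchings (the four-cycles); the exceptional patterns are returned. [cite: Lang2002, XV §1] -/
theorem gram_det_four_pairs_five (a₁₂ a₁₃ a₁₄ a₂₃ a₂₄ a₃₄ : ℕ) (h₁₂ : a₁₂ ≤ 1) (h₁₃ : a₁₃ ≤ 1) (h₁₄ : a₁₄ ≤ 1) (h₂₃ : a₂₃ ≤ 1) (h₂₄ : a₂₄ ≤ 1) (h₃₄ : a₃₄ ≤ 1) :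
    ((5 * (a₁₄ : ℚ) - 4) ^ 2 * (5 * (a₂₃ : ℚ) - 4) ^ 2 - 2 * (5 * (a₁₃ : ℚ) - 4) * (5 * (a₁₄ : ℚ) - 4) * (5 * (a₂₃ : ℚ) - 4) * (5 * (a₂₄ : ℚ) - 4) + (5 * (a₁₃ : ℚ) - 4) ^ 2 *
      (5 * (a₂₄ : ℚ) - 4) ^ 2 - 2 * (5 * (a₁₂ : ℚ) - 4) * (5 * (a₁₄ : ℚ) - 4) * (5 * (a₂₃ : ℚ) - 4) * (5 * (a₃₄ : ℚ) - 4) - 2 * (5 * (a₁₂ : ℚ) - 4) * (5 * (a₁₃ : ℚ) - 4) * (5 *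
      (a₂₄ : ℚ) - 4) * (5 * (a₃₄ : ℚ) - 4) + (5 * (a₁₂ : ℚ) - 4) ^ 2 * (5 * (a₃₄ : ℚ) - 4) ^ 2 + 12 * (5 * (a₂₃ : ℚ) - 4) * (5 * (a₂₄ : ℚ) - 4) * (5 * (a₃₄ : ℚ) - 4) + 12 * (5
      * (a₁₃ : ℚ) - 4) * (5 * (a₁₄ : ℚ) - 4) * (5 * (a₃₄ : ℚ) - 4) + 12 * (5 * (a₁₂ : ℚ) - 4) * (5 * (a₁₄ : ℚ) - 4) * (5 * (a₂₄ : ℚ) - 4) + 12 * (5 * (a₁₂ : ℚ) - 4) * (5 * (a₁₃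
      : ℚ) - 4) * (5 * (a₂₃ : ℚ) - 4) - 36 * (5 * (a₃₄ : ℚ) - 4) ^ 2 - 36 * (5 * (a₂₄ : ℚ) - 4) ^ 2 - 36 * (5 * (a₂₃ : ℚ) - 4) ^ 2 - 36 * (5 * (a₁₄ : ℚ) - 4) ^ 2 - 36 * (5 *
      (a₁₃ : ℚ) - 4) ^ 2 - 36 * (5 * (a₁₂ : ℚ) - 4) ^ 2 + 1296) ≠ 0 ∨
      (a₁₂ = 0 ∧ a₁₃ = 0 ∧ a₁₄ = 0) ∨ (a₁₂ = 0 ∧ a₂₃ = 0 ∧ a₂₄ = 0) ∨ (a₁₃ = 0 ∧ a₂₃ = 0 ∧ a₃₄ = 0) ∨ (a₁₄ = 0 ∧ a₂₄ = 0 ∧ a₃₄ = 0) ∨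
      (a₁₂ = 1 ∧ a₁₃ = 0 ∧ a₁₄ = 1 ∧ a₂₃ = 1 ∧ a₂₄ = 0 ∧ a₃₄ = 1) ∨ (a₁₂ = 0 ∧ a₁₃ = 1 ∧ a₁₄ = 1 ∧ a₂₃ = 1 ∧ a₂₄ = 1 ∧ a₃₄ = 0) ∨
      (a₁₂ = 1 ∧ a₁₃ = 1 ∧ a₁₄ = 0 ∧ a₂₃ = 0 ∧ a₂₄ = 1 ∧ a₃₄ = 1) := by
  rcases Nat.le_one_iff_eq_zero_or_eq_one.1 h₁₂ with rfl | rfl <;> rcases Nat.le_one_iff_eq_zero_or_eq_one.1 h₁₃ with rfl | rfl <;>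
    rcases Nat.le_one_iff_eq_zero_or_eq_one.1 h₁₄ with rfl | rfl <;> rcases Nat.le_one_iff_eq_zero_or_eq_one.1 h₂₃ with rfl | rfl <;>
    rcases Nat.le_one_iff_eq_zero_or_eq_one.1 h₂₄ with rfl | rfl <;> rcases Nat.le_one_iff_eq_zero_or_eq_one.1 h₃₄ with rfl | rfl
  all_goals norm_num

/-- The four-cycle pattern `Q₁ ∩ Q₃ = ∅ = Q₂ ∩ Q₄` (consecutive sets meeting once) together with the dependency read at a letter of degree `≠ 0, 2` forces the trivial
solution (`bᵢ = [y₀ ∈ Qᵢ]`). [cite: Lang2002, XV §1] -/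
theorem fourCycle_five_aux (g₁ g₂ g₃ g₄ b₁ b₂ b₃ b₄ : ℚ) (hb₁ : b₁ = 0 ∨ b₁ = 1) (hb₂ : b₂ = 0 ∨ b₂ = 1) (hb₃ : b₃ = 0 ∨ b₃ = 1) (hb₄ : b₄ = 0 ∨ b₄ = 1)
    (E₁ : 6 * g₁ + g₂ - 4 * g₃ + g₄ = 0) (E₂ : g₁ + 6 * g₂ + g₃ - 4 * g₄ = 0) (E₃ : -4 * g₁ + g₂ + 6 * g₃ + g₄ = 0)
    (hpt : (5 * b₁ - 2) * g₁ + (5 * b₂ - 2) * g₂ + (5 * b₃ - 2) * g₃ + (5 * b₄ - 2) * g₄ = 0) (hd0 : b₁ + b₂ + b₃ + b₄ ≠ 0) (hd2 : b₁ + b₂ + b₃ + b₄ ≠ 2)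
    (hx₁₃ : ¬ (b₁ = 1 ∧ b₃ = 1)) (hx₂₄ : ¬ (b₂ = 1 ∧ b₄ = 1)) : g₁ = 0 ∧ g₂ = 0 ∧ g₃ = 0 ∧ g₄ = 0 := by
  rcases hb₁ with rfl | rfl <;> rcases hb₂ with rfl | rfl <;> rcases hb₃ with rfl | rfl <;> rcases hb₄ with rfl | rfl
  -- degrees `0`, `2`, `4` and the opposite incidences contradict `hd0`, `hd2`, `hx₁₃`, `hx₂₄`; degree `1` is settled by elimination
  all_goals norm_num at hd0
  all_goals norm_num at hd2
  all_goals norm_num at hx₁₃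
  all_goals norm_num at hx₂₄
  all_goals norm_num at hpt
  all_goals exact ⟨by linarith only [E₁, E₂, E₃, hpt], by linarith only [E₁, E₂, E₃, hpt], by linarith only [E₁, E₂, E₃, hpt], by linarith only [E₁, E₂, E₃, hpt]⟩

/-- **FOUR DISTINCT `2`-SETS ON FIVE LETTERS WITH (H1) EVERY SET MEETING ANOTHER AND (H2) A LETTER IN `1`, `3` OR `4` OF THEM HAVE INDEPENDENT CENTRED INDICATORS** — every
letter pattern except the four-cycle and the triangle with the disjoint edge (enumerated form). [cite: Lang2002, XV §1] -/
theorem linearIndependent_cells_of_four_pairs_five (hk : k = 5) {ι : Type} [Fintype ι] (i₁ i₂ i₃ i₄ : ι) (h₁₂ : i₁ ≠ i₂) (h₁₃ : i₁ ≠ i₃) (h₁₄ : i₁ ≠ i₄)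
    (h₂₃ : i₂ ≠ i₃) (h₂₄ : i₂ ≠ i₄) (h₃₄ : i₃ ≠ i₄) (huniv : ∀ i, i = i₁ ∨ i = i₂ ∨ i = i₃ ∨ i = i₄) (Q : ι → Finset (Fin k)) (hc : ∀ i, (Q i).card = 2)
    (hQ : Function.Injective Q) (hmeet : ∀ i, ∃ j, j ≠ i ∧ (Q i ∩ Q j).Nonempty)
    (hodd : ∃ y : Fin k, (Finset.univ.filter fun i => y ∈ Q i).card ≠ 0 ∧ (Finset.univ.filter fun i => y ∈ Q i).card ≠ 2) :
    LinearIndependent ℚ fun i : ι => fun y : Fin k => ((k : ℚ) * (if y ∈ Q i then 1 else 0) - (Q i).card) := by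
  -- pairwise intersections have at most one letter
  have ht₁₂ := card_inter_le_one_of_ne (hc i₁) (hc i₂) (fun h => h₁₂ (hQ h).symm)
  have ht₁₃ := card_inter_le_one_of_ne (hc i₁) (hc i₃) (fun h => h₁₃ (hQ h).symm)
  have ht₁₄ := card_inter_le_one_of_ne (hc i₁) (hc i₄) (fun h => h₁₄ (hQ h).symm)
  have ht₂₃ := card_inter_le_one_of_ne (hc i₂) (hc i₃) (fun h => h₂₃ (hQ h).symm)
  have ht₂₄ := card_inter_le_one_of_ne (hc i₂) (hc i₄) (fun h => h₂₄ (hQ h).symm)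
  have ht₃₄ := card_inter_le_one_of_ne (hc i₃) (hc i₄) (fun h => h₃₄ (hQ h).symm)
  -- (H1): no set is disjoint from the three others
  have hne0 : ∀ i j, (Q i ∩ Q j).Nonempty → (Q i ∩ Q j).card ≠ 0 := fun i j h => (Finset.card_pos.2 h).ne'
  have hm₁ : ¬ ((Q i₁ ∩ Q i₂).card = 0 ∧ (Q i₁ ∩ Q i₃).card = 0 ∧ (Q i₁ ∩ Q i₄).card = 0) := fun ⟨ha, hb, hc'⟩ => by
    obtain ⟨j, hj, hn⟩ := hmeet i₁
    rcases huniv j with rfl | rfl | rfl | rfl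
    exacts [hj rfl, hne0 _ _ hn ha, hne0 _ _ hn hb, hne0 _ _ hn hc']
  have hm₂ : ¬ ((Q i₁ ∩ Q i₂).card = 0 ∧ (Q i₂ ∩ Q i₃).card = 0 ∧ (Q i₂ ∩ Q i₄).card = 0) := fun ⟨ha, hb, hc'⟩ => by
    obtain ⟨j, hj, hn⟩ := hmeet i₂
    rcases huniv j with rfl | rfl | rfl | rfl
    exacts [hne0 _ _ hn (by rw [Finset.inter_comm]; exact ha), hj rfl, hne0 _ _ hn hb, hne0 _ _ hn hc']
  have hm₃ : ¬ ((Q i₁ ∩ Q i₃).card = 0 ∧ (Q i₂ ∩ Q i₃).card = 0 ∧ (Q i₃ ∩ Q i₄).card = 0) := fun ⟨ha, hb, hc'⟩ => by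
    obtain ⟨j, hj, hn⟩ := hmeet i₃
    rcases huniv j with rfl | rfl | rfl | rfl
    exacts [hne0 _ _ hn (by rw [Finset.inter_comm]; exact ha), hne0 _ _ hn (by rw [Finset.inter_comm]; exact hb), hj rfl, hne0 _ _ hn hc']
  have hm₄ : ¬ ((Q i₁ ∩ Q i₄).card = 0 ∧ (Q i₂ ∩ Q i₄).card = 0 ∧ (Q i₃ ∩ Q i₄).card = 0) := fun ⟨ha, hb, hc'⟩ => by
    obtain ⟨j, hj, hn⟩ := hmeet i₄
    rcases huniv j with rfl | rfl | rfl | rfl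
    exacts [hne0 _ _ hn (by rw [Finset.inter_comm]; exact ha), hne0 _ _ hn (by rw [Finset.inter_comm]; exact hb),
      hne0 _ _ hn (by rw [Finset.inter_comm]; exact hc'), hj rfl]
  -- (H2): the odd letter, its incidences `bᵢ = [y₀ ∈ Qᵢ]`, its degree
  obtain ⟨y₀, hd0, hd2⟩ := hodd
  let b : ι → ℚ := fun i => if y₀ ∈ Q i then 1 else 0
  have hb : ∀ i, b i = 0 ∨ b i = 1 := fun i => by by_cases h : y₀ ∈ Q i <;> simp [b, h]
  have hdq : ((Finset.univ.filter fun i => y₀ ∈ Q i).card : ℚ) = b i₁ + b i₂ + b i₃ + b i₄ := by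
    rw [Finset.natCast_card_filter, sum_eq_four i₁ i₂ i₃ i₄ h₁₂ h₁₃ h₁₄ h₂₃ h₂₄ h₃₄ huniv]
  have hb0 : b i₁ + b i₂ + b i₃ + b i₄ ≠ 0 := fun h => hd0 (by rw [← hdq, Nat.cast_eq_zero] at h; exact h)
  have hb2 : b i₁ + b i₂ + b i₃ + b i₄ ≠ 2 := fun h => hd2 (by rw [← hdq] at h; exact_mod_cast h)
  have hx : ∀ {i j}, (Q i ∩ Q j).card = 0 → ¬ (b i = 1 ∧ b j = 1) := by
    intro i j h0 hij
    have hi' : y₀ ∈ Q i := by by_contra hn; have h1 := hij.1; simp [b, hn] at h1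
    have hj' : y₀ ∈ Q j := by by_contra hn; have h1 := hij.2; simp [b, hn] at h1
    exact hne0 _ _ ⟨y₀, Finset.mem_inter.2 ⟨hi', hj'⟩⟩ h0
  subst hk
  rw [Fintype.linearIndependent_iff]
  intro g hg
  -- the Gram equations and the dependency read at the odd letter
  have E₁ := gram_eq_zero_of_sum_smul_eq_zero Q hg i₁
  have E₂ := gram_eq_zero_of_sum_smul_eq_zero Q hg i₂
  have E₃ := gram_eq_zero_of_sum_smul_eq_zero Q hg i₃
  have E₄ := gram_eq_zero_of_sum_smul_eq_zero Q hg i₄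
  have hpt := apply_cells_eq_zero_of_sum_smul_eq_zero Q hg y₀
  rw [sum_eq_four i₁ i₂ i₃ i₄ h₁₂ h₁₃ h₁₄ h₂₃ h₂₄ h₃₄ huniv] at E₁ E₂ E₃ E₄ hpt
  rw [Finset.inter_comm (Q i₂) (Q i₁), Finset.inter_comm (Q i₃) (Q i₁), Finset.inter_comm (Q i₄) (Q i₁)] at E₁
  rw [Finset.inter_comm (Q i₃) (Q i₂), Finset.inter_comm (Q i₄) (Q i₂)] at E₂
  rw [Finset.inter_comm (Q i₄) (Q i₃)] at E₃
  simp only [Finset.inter_self, hc] at E₁ E₂ E₃ E₄ hpt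
  push_cast at E₁ E₂ E₃ E₄ hpt
  have hpt' : (5 * b i₁ - 2) * g i₁ + (5 * b i₂ - 2) * g i₂ + (5 * b i₃ - 2) * g i₃ + (5 * b i₄ - 2) * g i₄ = 0 := by linear_combination hpt
  -- the adjugate identity; the determinant vanishes only at the claws (H1) and the four-cycles (H2)
  obtain ⟨D₁, D₂, D₃, D₄⟩ := det_mul_eq_zero_of_gram_four (g i₁) (g i₂) (g i₃) (g i₄) (5 * ((Q i₁ ∩ Q i₂).card : ℚ) - 4) (5 * ((Q i₁ ∩ Q i₃).card : ℚ) - 4)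
    (5 * ((Q i₁ ∩ Q i₄).card : ℚ) - 4) (5 * ((Q i₂ ∩ Q i₃).card : ℚ) - 4) (5 * ((Q i₂ ∩ Q i₄).card : ℚ) - 4) (5 * ((Q i₃ ∩ Q i₄).card : ℚ) - 4)
    (by linear_combination (1 / 5 : ℚ) * E₁) (by linear_combination (1 / 5 : ℚ) * E₂) (by linear_combination (1 / 5 : ℚ) * E₃) (by linear_combination (1 / 5 : ℚ) * E₄)
  have hboth : g i₁ = 0 ∧ g i₂ = 0 ∧ g i₃ = 0 ∧ g i₄ = 0 := by
    rcases gram_det_four_pairs_five _ _ _ _ _ _ ht₁₂ ht₁₃ ht₁₄ ht₂₃ ht₂₄ ht₃₄ with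
      hD | h | h | h | h | ⟨a₁₂, a₁₃, a₁₄, a₂₃, a₂₄, a₃₄⟩ | ⟨a₁₂, a₁₃, a₁₄, a₂₃, a₂₄, a₃₄⟩ | ⟨a₁₂, a₁₃, a₁₄, a₂₃, a₂₄, a₃₄⟩
    · exact ⟨(mul_eq_zero.1 D₁).resolve_left hD, (mul_eq_zero.1 D₂).resolve_left hD, (mul_eq_zero.1 D₃).resolve_left hD, (mul_eq_zero.1 D₄).resolve_left hD⟩
    · exact absurd h hm₁
    · exact absurd h hm₂
    · exact absurd h hm₃
    · exact absurd h hm₄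
    all_goals
      simp only [a₁₂, a₁₃, a₁₄, a₂₃, a₂₄, a₃₄] at E₁ E₂ E₃ E₄
      norm_num at E₁ E₂ E₃ E₄
    · -- the four-cycle `Q₁ Q₂ Q₃ Q₄` (opposite pairs `13`, `24`)
      exact fourCycle_five_aux (g i₁) (g i₂) (g i₃) (g i₄) (b i₁) (b i₂) (b i₃) (b i₄) (hb i₁) (hb i₂) (hb i₃) (hb i₄) (by linear_combination (1 / 5 : ℚ) * E₁)
        (by linear_combination (1 / 5 : ℚ) * E₂) (by linear_combination (1 / 5 : ℚ) * E₃) hpt' hb0 hb2 (hx a₁₃) (hx a₂₄)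
    · -- the four-cycle `Q₁ Q₃ Q₂ Q₄` (opposite pairs `12`, `34`)
      have h := fourCycle_five_aux (g i₁) (g i₃) (g i₂) (g i₄) (b i₁) (b i₃) (b i₂) (b i₄) (hb i₁) (hb i₃) (hb i₂) (hb i₄) (by linear_combination (1 / 5 : ℚ) * E₁)
        (by linear_combination (1 / 5 : ℚ) * E₃) (by linear_combination (1 / 5 : ℚ) * E₂) (by linear_combination hpt') (fun h => hb0 (by linear_combination h))
        (fun h => hb2 (by linear_combination h)) (hx a₁₂) (hx a₃₄)
      exact ⟨h.1, h.2.2.1, h.2.1, h.2.2.2⟩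
    · -- the four-cycle `Q₁ Q₂ Q₄ Q₃` (opposite pairs `14`, `23`)
      have h := fourCycle_five_aux (g i₁) (g i₂) (g i₄) (g i₃) (b i₁) (b i₂) (b i₄) (b i₃) (hb i₁) (hb i₂) (hb i₄) (hb i₃) (by linear_combination (1 / 5 : ℚ) * E₁)
        (by linear_combination (1 / 5 : ℚ) * E₂) (by linear_combination (1 / 5 : ℚ) * E₄) (by linear_combination hpt') (fun h => hb0 (by linear_combination h))
        (fun h => hb2 (by linear_combination h)) (hx a₁₄) (hx a₂₃)
      exact ⟨h.1, h.2.1, h.2.2.2, h.2.2.1⟩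
  intro i
  rcases huniv i with rfl | rfl | rfl | rfl
  exacts [hboth.1, hboth.2.1, hboth.2.2.1, hboth.2.2.2]

/-- **FOUR DISTINCT `2`-SETS ON FIVE LETTERS WITH (H1)–(H2) HAVE INDEPENDENT CENTRED INDICATORS** (cardinality form: any index type of four elements).
[cite: Lang2002, XV §1] -/
theorem linearIndependent_cells_of_four_pairs_five_of_card_eq_four (hk : k = 5) {ι : Type} [Fintype ι] (hι : Fintype.card ι = 4) (Q : ι → Finset (Fin k))
    (hc : ∀ i, (Q i).card = 2) (hQ : Function.Injective Q) (hmeet : ∀ i, ∃ j, j ≠ i ∧ (Q i ∩ Q j).Nonempty)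
    (hodd : ∃ y : Fin k, (Finset.univ.filter fun i => y ∈ Q i).card ≠ 0 ∧ (Finset.univ.filter fun i => y ∈ Q i).card ≠ 2) :
    LinearIndependent ℚ fun i : ι => fun y : Fin k => ((k : ℚ) * (if y ∈ Q i then 1 else 0) - (Q i).card) := by
  obtain ⟨i₁, i₂, i₃, i₄, h₁₂, h₁₃, h₁₄, h₂₃, h₂₄, h₃₄, huniv⟩ := exists_enum_of_card_eq_four hι
  exact linearIndependent_cells_of_four_pairs_five hk i₁ i₂ i₃ i₄ h₁₂ h₁₃ h₁₄ h₂₃ h₂₄ h₃₄ huniv Q hc hQ hmeet hodd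

/-- **THREE DISTINCT `2`-SETS ON FIVE LETTERS HAVE INDEPENDENT CENTRED INDICATORS** (cardinality form of U5a's triple lemma). [cite: Lang2002, XV §1] -/
theorem linearIndependent_cells_of_three_pairs_five_of_card_eq_three (hk : k = 5) {ι : Type} [Fintype ι] (hι : Fintype.card ι = 3) (Q : ι → Finset (Fin k))
    (hc : ∀ i, (Q i).card = 2) (hQ : Function.Injective Q) :
    LinearIndependent ℚ fun i : ι => fun y : Fin k => ((k : ℚ) * (if y ∈ Q i then 1 else 0) - (Q i).card) := by
  obtain ⟨i₁, i₂, i₃, h₁₂, h₁₃, h₂₃, huniv⟩ := exists_enum_of_card_eq_three hι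
  exact linearIndependent_cells_of_three_pairs_five hk i₁ i₂ i₃ h₁₂ h₁₃ h₂₃ huniv Q (hc i₁) (hc i₂) (hc i₃) (fun h => h₁₂ (hQ h).symm)
    (fun h => h₁₃ (hQ h).symm) (fun h => h₂₃ (hQ h).symm)

end Four

/-! ## §4 Honesty: the four-cycle and the triangle with the disjoint edge are dependent -/

section Dependent

/-- **THE FOUR-CYCLE IS DEPENDENT**: on five letters `v_{01} − v_{12} + v_{23} − v_{03} = 0`. [cite: Lang2002, XIII §4] -/
theorem not_linearIndependent_cells_fourCycle_five :
    ¬ LinearIndependent ℚ fun i : Fin 4 => fun y : Fin 5 =>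
      ((5 : ℚ) * (if y ∈ (![({0, 1} : Finset (Fin 5)), {1, 2}, {2, 3}, {0, 3}] i) then 1 else 0) - ((![({0, 1} : Finset (Fin 5)), {1, 2}, {2, 3}, {0, 3}] i).card : ℚ)) := by
  rw [Fintype.not_linearIndependent_iff]
  refine ⟨![1, -1, 1, -1], ?_, 0, by norm_num⟩
  funext y
  rw [Finset.sum_apply, Pi.zero_apply, Fin.sum_univ_four]
  fin_cases y <;> simp <;> norm_num

/-- **THE TRIANGLE WITH THE DISJOINT EDGE IS DEPENDENT**: on five letters `v_{01} + v_{02} + v_{12} + 2·v_{34} = 0`. [cite: Lang2002, XIII §4] -/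
theorem not_linearIndependent_cells_triangle_edge_five :
    ¬ LinearIndependent ℚ fun i : Fin 4 => fun y : Fin 5 =>
      ((5 : ℚ) * (if y ∈ (![({0, 1} : Finset (Fin 5)), {0, 2}, {1, 2}, {3, 4}] i) then 1 else 0) - ((![({0, 1} : Finset (Fin 5)), {0, 2}, {1, 2}, {3, 4}] i).card : ℚ)) := by
  rw [Fintype.not_linearIndependent_iff]
  refine ⟨![1, 1, 1, 2], ?_, 0, by norm_num⟩
  funext y
  rw [Finset.sum_apply, Pi.zero_apply, Fin.sum_univ_four]
  fin_cases y <;> simp <;> norm_num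

end Dependent

end Summit.HodgeConjecture.CorCM.MultiFieldWeil

end
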